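import Summits.QuantumFields.YangMills.Theorems.BalabanUVNodesN21AtSpineCarriers
import Literature.MathematicalPhysics.QuantumFieldTheory.Balaban1983to89.T4FiniteEpsInhabited

/-!
# YM-DAG node N21 (= NE7c) at the spine carriers — SANITY ∕ VACUITY GUARD for file 8 `BalabanUVNodesN21AtSpineCarriers`:
# the reading predicates of `s_N21_of_slotLedgersReading` ∕ `s_N21_of_levelsReading` are INHABITED by non-degenerate data
# (a four-torus family, an `SU(2)` datum, a string, a carrier bundle with nonempty classes, unit weights, shells `ϑ^K > 0`,
# record weight `2ϑ^K > 0`), and `S_N21` FIRES on them by the K5 theorems — the vacuity audit A1–A6 in kernel form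

Track A of `YM-PLAN.md` (cell `pub-ymgap`, HUMAN RULING D-0062), node **N21**; seat `pub-ymgap-dag-n21-a`, generation 4, file 8′ (companion of
file 8 p417321, as files 3′ p411126 ∕ 6′ p415073 were for files 3 ∕ 6).  Kernel bookkeeping: 0 `def`, 0 `sorry`, standard axioms.  COUNT-NEUTRAL.

HONEST FRAMING.  A vacuity guard, not an estimate: it shows that the hypothesis binder `hread` of file 8's K5 theorems is not void — there IS a
carrier predicate of the stated reading shape, inhabited at some `(F, D, g₀, os, S)` with non-degenerate carriers (the one-slot toy of
`T4ShellMeasureLevels.Toy`: one term of unit weight per run and step, shell part `ϑ^K`, one slot at the top level, `D = 1`, `ρ_j = ϑ^j`), and that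
`S_N21` of that predicate is delivered by `s_N21_of_slotLedgersReading` ∕ `s_N21_of_levelsReading` with the NONZERO record weight `2ϑ^K`.
Nothing of Bałaban's is asserted; the carriers OF RECORD (NODE 00 Stage 5 ∕ NODE O) are not these; NE7c NOT PRINTED, NOT proved; one finite
four-torus at fixed `ε`; NOT continuum ∕ ℝ⁴ ∕ OS ∕ mass gap ∕ Clay.
-/

set_option autoImplicit false

noncomputable section

open scoped BigOperators

namespace Summit.QuantumFields.YangMills.Theorems.N21AtSpineCarriers

open Literature.MathematicalPhysics.QuantumFieldTheory.Balaban1983to89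
open T4IndicatorShell (ShellWeightBound)
open T4ShellMeasure (SlotLedger)
open T4ShellMeasureLevels (LevelLedger LiveWindow)
open T4ShellMeasureLevels.Toy
open YMDAG.UVSplit (SpineCarriers SpineRecordPred S_N21)
open Finset

/-! ## §1 The toy carrier bundle is non-degenerate -/

/-- A four-torus family exists (`L = 13`, `m = 1`), hence so does an `SU(2)` datum on it (`T4FiniteEpsInhabited.nonempty_finiteEpsData_SU`):
the prefix `∀ F D` of every `S_<node>` stub ranges over inhabited types. [folklore] -/
theorem exists_family_and_datum : ∃ F : T4Continuum.T4Family, Nonempty (YMDAG.UVSplit.Datum F 2) :=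
  ⟨⟨13, ⟨⟨6, rfl⟩, by norm_num⟩, by norm_num, 1, le_rfl⟩, T4FiniteEpsInhabited.nonempty_finiteEpsData_SU _ 2⟩

/-- The toy's per-slot relative constants sum to `ϑ^K` over the one slot of step `K`. [folklore] -/
theorem toy_slotSum_eq (ϑ : ℝ) (K : ℕ) : ∑ s ∈ S K, D (lvl K s) * ρ ϑ (lvl K s) = ϑ ^ K := by
  simp [S, D, ρ, lvl]

/-! ## §2 `S_N21` FIRES on the slot-ledger reading -/

/-- **THE SLOT-LEDGER READING IS INHABITED AND `S_N21` FIRES ON IT.**  For `0 < ϑ < 1` there is a carrier predicate `SRec` over `SU(2)` data such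
that (i) `SRec` is a slot-ledger READING predicate — every bundle it pins carries EXACTLY the package of `s_N21_of_slotLedgersReading`; (ii) it
is INHABITED: some family, datum, bare sequence, string and bundle satisfy it, the bundle having nonempty classes, positive weights, positive
shell parts and positive record weight `S.Wsh K = 2ϑ^K` at every step; (iii) `S_N21 SRec` holds (by `s_N21_of_slotLedgersReading`).  So file 8's
binder is not void and its conclusion is not the empty implication. [folklore] -/
theorem s_N21_fires_on_slotLedgersReading (l₀ : ℝ) {ϑ : ℝ} (h0 : 0 < ϑ) (h1 : ϑ < 1) :
    ∃ SRec : SpineRecordPred 2,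
      (∀ (F : T4Continuum.T4Family) (D : YMDAG.UVSplit.Datum F 2) (g₀ : ℕ → ℝ) (os : List (T4Continuum.ULoop F))
          (S : SpineCarriers), SRec F D g₀ os S →
        ∃ (σA σB : Type) (SA : ℕ → Finset σA) (SB : ℕ → Finset σB) (pieceA : ℕ → ℝ → σA → S.ι → ℝ)
          (pieceB : ℕ → ℝ → σB → S.ι → ℝ) (cA : ℕ → σA → ℝ) (cB : ℕ → σB → ℝ) (C ϑ : ℝ),
          SlotLedger S.l₀ S.T S.A S.shA SA pieceA cA ∧ SlotLedger S.l₀ S.T S.B S.shB SB pieceB cB ∧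
          0 ≤ ϑ ∧ ϑ < 1 ∧ (∀ K, ∑ s ∈ SA K, cA K s ≤ C * ϑ ^ K) ∧ (∀ K, ∑ s ∈ SB K, cB K s ≤ C * ϑ ^ K) ∧
          (∀ K, ∑ s ∈ SA K, cA K s + ∑ s ∈ SB K, cB K s ≤ S.Wsh K) ∧ Summable S.Wsh) ∧
      (∃ (F : T4Continuum.T4Family) (D : YMDAG.UVSplit.Datum F 2) (g₀ : ℕ → ℝ) (os : List (T4Continuum.ULoop F))
          (S : SpineCarriers), SRec F D g₀ os S ∧ (∀ K, (S.T K).Nonempty) ∧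
          (∀ K t τ, 0 < S.A K t τ ∧ 0 < S.B K t τ ∧ 0 < S.shA K t τ ∧ 0 < S.shB K t τ) ∧ ∀ K, 0 < S.Wsh K) ∧
      S_N21 SRec := by
  obtain ⟨F, ⟨Dat⟩⟩ := exists_family_and_datum
  have hL : LevelLedger l₀ T A (sh ϑ) S (piece ϑ) lvl D (ρ ϑ) := levelLedger l₀ h0.le h1.le
  have hsum : Summable fun K : ℕ => 2 * ϑ ^ K := (summable_geometric_of_lt_one h0.le h1).mul_left 2
  refine ⟨_, fun _ _ _ _ _ h => h, ?_, s_N21_of_slotLedgersReading _ fun _ _ _ _ _ h => h⟩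
  refine ⟨F, Dat, fun _ => 0, [],
    { ι := Unit, l₀ := l₀, vol := 1, K₀ := 0, T := T, A := A, B := A, shA := sh ϑ, shB := sh ϑ, Bad := fun _ _ => ∅,
      W := fun _ => 0, Wsh := fun K => 2 * ϑ ^ K, δ := fun _ => 0 }, ?_, ?_, ?_, ?_⟩
  · refine ⟨Unit, Unit, S, S, piece ϑ, piece ϑ, fun K s => D (lvl K s) * ρ ϑ (lvl K s),
      fun K s => D (lvl K s) * ρ ϑ (lvl K s), 1, ϑ, hL.toSlotLedger, hL.toSlotLedger, h0.le, h1, ?_, ?_, ?_, hsum⟩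
    · intro K; rw [toy_slotSum_eq, one_mul]
    · intro K; rw [toy_slotSum_eq, one_mul]
    · intro K; simp only [toy_slotSum_eq]; linarith
  · intro K; exact ⟨(), by simp [T]⟩
  · intro K t τ
    exact ⟨by simp [A], by simp [A], by simpa [sh] using pow_pos h0 K, by simpa [sh] using pow_pos h0 K⟩
  · intro K; simp only; positivity

/-! ## §3 `S_N21` FIRES on the road-I (levels) reading -/

/-- **THE ROAD-I READING IS INHABITED AND `S_N21` FIRES ON IT.**  As §2 for the package of `s_N21_of_levelsReading`: two `LevelLedger`s
(`T4ShellMeasureLevels.Toy.levelLedger`), two `LiveWindow`s of depth `N₁ = 0` and count `ν̄ = 1` (`Toy.liveWindow`), `D ≤ D̄ = 1`, rate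
`ρ_j = ϑ^j ≤ 1·ϑ^j`, and record weight `S.Wsh K = 2ϑ^K = 2((0+1)·1·1·1·ϑ^{−0})ϑ^K` — inhabited by the same non-degenerate toy bundle, and `S_N21 SRec`
by `s_N21_of_levelsReading`. [folklore] -/
theorem s_N21_fires_on_levelsReading (l₀ : ℝ) {ϑ : ℝ} (h0 : 0 < ϑ) (h1 : ϑ < 1) :
    ∃ SRec : SpineRecordPred 2,
      (∀ (F : T4Continuum.T4Family) (D : YMDAG.UVSplit.Datum F 2) (g₀ : ℕ → ℝ) (os : List (T4Continuum.ULoop F))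
          (S : SpineCarriers), SRec F D g₀ os S →
        ∃ (σA σB : Type) (SA : ℕ → Finset σA) (SB : ℕ → Finset σB) (pieceA : ℕ → ℝ → σA → S.ι → ℝ)
          (pieceB : ℕ → ℝ → σB → S.ι → ℝ) (lvlA : ℕ → σA → ℕ) (lvlB : ℕ → σB → ℕ) (DA ρA DB ρB : ℕ → ℝ)
          (N₁ : ℕ) (νbar Dbar c₁ ϑ : ℝ),
          LevelLedger S.l₀ S.T S.A S.shA SA pieceA lvlA DA ρA ∧ LevelLedger S.l₀ S.T S.B S.shB SB pieceB lvlB DB ρB ∧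
          LiveWindow SA lvlA N₁ νbar ∧ LiveWindow SB lvlB N₁ νbar ∧ (∀ j, DA j ≤ Dbar) ∧ (∀ j, DB j ≤ Dbar) ∧
          0 < ϑ ∧ ϑ < 1 ∧ (∀ j, ρA j ≤ c₁ * ϑ ^ j) ∧ (∀ j, ρB j ≤ c₁ * ϑ ^ j) ∧
          (∀ K, (2 * ((N₁ + 1) * νbar * Dbar * c₁ * ϑ⁻¹ ^ N₁)) * ϑ ^ K ≤ S.Wsh K) ∧ Summable S.Wsh) ∧
      (∃ (F : T4Continuum.T4Family) (D : YMDAG.UVSplit.Datum F 2) (g₀ : ℕ → ℝ) (os : List (T4Continuum.ULoop F))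
          (S : SpineCarriers), SRec F D g₀ os S ∧ (∀ K, (S.T K).Nonempty) ∧
          (∀ K t τ, 0 < S.A K t τ ∧ 0 < S.B K t τ ∧ 0 < S.shA K t τ ∧ 0 < S.shB K t τ) ∧ ∀ K, 0 < S.Wsh K) ∧
      S_N21 SRec := by
  obtain ⟨F, ⟨Dat⟩⟩ := exists_family_and_datum
  have hL : LevelLedger l₀ T A (sh ϑ) S (piece ϑ) lvl D (ρ ϑ) := levelLedger l₀ h0.le h1.le
  have hsum : Summable fun K : ℕ => 2 * ϑ ^ K := (summable_geometric_of_lt_one h0.le h1).mul_left 2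
  refine ⟨_, fun _ _ _ _ _ h => h, ?_, s_N21_of_levelsReading _ fun _ _ _ _ _ h => h⟩
  refine ⟨F, Dat, fun _ => 0, [],
    { ι := Unit, l₀ := l₀, vol := 1, K₀ := 0, T := T, A := A, B := A, shA := sh ϑ, shB := sh ϑ, Bad := fun _ _ => ∅,
      W := fun _ => 0, Wsh := fun K => 2 * ϑ ^ K, δ := fun _ => 0 }, ?_, ?_, ?_, ?_⟩
  · refine ⟨Unit, Unit, S, S, piece ϑ, piece ϑ, lvl, lvl, D, ρ ϑ, D, ρ ϑ, 0, 1, 1, 1, ϑ, hL, hL, liveWindow, liveWindow,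
      fun _ => le_rfl, fun _ => le_rfl, h0, h1, fun j => (one_mul _).symm.le, fun j => (one_mul _).symm.le, ?_, hsum⟩
    intro K
    have e : (2 * ((((0 : ℕ) : ℝ) + 1) * 1 * 1 * 1 * ϑ⁻¹ ^ 0)) * ϑ ^ K = 2 * ϑ ^ K := by push_cast; ring
    rw [e]
  · intro K; exact ⟨(), by simp [T]⟩
  · intro K t τ
    exact ⟨by simp [A], by simp [A], by simpa [sh] using pow_pos h0 K, by simpa [sh] using pow_pos h0 K⟩
  · intro K; simp only; positivity

/-! ## §4 The A2 trap, located: `S_N21` ALONE is satisfiable by the zero-shell junk reading — its content is fixed only JOINTLY with `S_N19` -/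

/-- **A2 (junk-witness) TRAP, LOCATED.**  If a carrier predicate pins bundles with NO shell parts (`S.shA = S.shB = 0`), zero record weight
(`S.Wsh = 0`) and termwise nonnegative weights on `|t| ≤ S.l₀`, then `S_N21 SRec` holds with no estimate at all (`ShellWeightBound l₀ T A B 0 0 0`).
So the K5 stub `S_N21` is NOT protected against junk by its own text: what protects the join `SpineMatching_of` is that the SAME bundle `S` feeds
`S_N19` on the cores `A − shA`, `B − shB` (with zero shells the core matching `NE7.Core` must then hold on the FULL terms, which is exactly what the
shell carve-out of `T4IndicatorShell` (design (i), common refinement) exists to avoid) and `S_N27x` (the class sums ARE the partition functions).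
Reading for NODE O ∕ the record predicate's author: `shA`∕`shB` must be pinned as the mismatch parts of the two runs' indicator products, once, for
N19 and N21 together. [folklore] -/
theorem s_N21_of_zeroShellReading {N : ℕ} [NeZero N] (SRec : SpineRecordPred N)
    (hread : ∀ (F : T4Continuum.T4Family) (D : YMDAG.UVSplit.Datum F N) (g₀ : ℕ → ℝ) (os : List (T4Continuum.ULoop F))
      (S : SpineCarriers), SRec F D g₀ os S →
        (∀ K t τ, S.shA K t τ = 0) ∧ (∀ K t τ, S.shB K t τ = 0) ∧ (∀ K, S.Wsh K = 0) ∧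
        (∀ K t, |t| ≤ S.l₀ → ∀ τ ∈ S.T K, 0 ≤ S.A K t τ) ∧ (∀ K t, |t| ≤ S.l₀ → ∀ τ ∈ S.T K, 0 ≤ S.B K t τ)) :
    S_N21 SRec := by
  intro F D g₀ os S hS
  obtain ⟨hA0, hB0, hW0, hA, hB⟩ := hread F D g₀ os S hS
  exact
    { nonneg := fun K => (hW0 K).symm.le
      summable := (summable_congr hW0).2 summable_zero
      sh_nonneg_left := fun K t _ τ _ => (hA0 K t τ).symm.le
      sh_le_left := fun K t ht τ hτ => (hA0 K t τ).trans_le (hA K t ht τ hτ)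
      sh_nonneg_right := fun K t _ τ _ => (hB0 K t τ).symm.le
      sh_le_right := fun K t ht τ hτ => (hB0 K t τ).trans_le (hB K t ht τ hτ)
      left := fun K t ht => by
        rw [Finset.sum_congr rfl fun τ _ => hA0 K t τ, Finset.sum_const_zero, hW0, zero_mul]
      right := fun K t ht => by
        rw [Finset.sum_congr rfl fun τ _ => hB0 K t τ, Finset.sum_const_zero, hW0, zero_mul] }

end Summit.QuantumFields.YangMills.Theorems.N21AtSpineCarriers

end
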